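import Summits.PneNP.PneNP.Theorems.ChebyshevTracialDesignPatternProfileSmoothness
import Summits.PneNP.PneNP.Theorems.ChebyshevTracialDesignJuntaVirtualPositivity
import Literature.Combinatorics.Optimization.ExactDesignRemainder
import HarnessLib

/-!
# Cell pnp-psdrank, route `ChebyshevTracialDesign`: JUNTA PRICING BEYOND THE DESIGN DEGREE — for an exact design of degree `D` and a psd
# `A`-junta cut field of ANY size `|A|`, against EVERY psd matching field, the design value is at most the Newton remainder
# `B_v·C(T,D+1)·Λ̄·4^{|A|}·C(|A|,D+1)(D+1)!·N^{|A|−D−1}/[N]_{|A|}` (`Λ̄` the matching-average of the trace bounds) — zero for `|A| ≤ D`,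
# super-polynomially small for `|A| = O(D)`, and at the per-matching scale `|PM|⁻¹` for a single matching (crux `TracialDecayExp20`,
# stmt-PneNP-19878)

Brick 110b (prover g20; eng MEMO-18 §5 (P2)/(P3), lit g30 `Literature/…/ExactDesignRemainder` (MEMO-22 §5 (L2)), MEMO-23 §2). Junta virtual positivity
(`…JuntaVirtualPositivity.sum_levelWeight_trace_nonpos_of_junta`, the BC5 rung N1) prices a psd `A`-junta field `X` against every psd `Y` at `≤ 0`
EXACTLY — but only for `|A| ≤ D`, the exactness degree of the design, because the per-matching level profile `T(N;c,i)·P_M(c)` has `deg P_M ≤ |A|`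
and is read at the virtual level through exactness. This file removes the degree wall at the price of the design's NEWTON REMAINDER:
* §1 `card_window_le` (`|W| ≤ 2|E|`), **`junta_sum_law_smooth`** — the junta sum law of `…JuntaPatternLaw` WITH DERIVATIVE BOUNDS: for a perfect
  matching `M` of `S` (`N = |M|`), window edges `E ⊆ M` (`x = |E|`, window `W`; `2x ≤ t+2`, `2x+t ≤ 2N+2`, `t ≤ 2N`) and `G` depending on `t`-sets only
  on `U ∩ W` with values in `[0, Λ_max]`, the level sums of `G` are `T(N;c,i)·P(c)` for ONE polynomial `P`, `deg P ≤ x`, `P(0) ≥ 0`, with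
  `|P^{(m)}(ξ)| ≤ Λ_max·2^{|W|}·C(x,m)·m!·N^{x−m}/[N]_x` for all `m`, `ξ ∈ [0,N]` (`P = Σ_{B⊆W} Λ(B) P_B`, brick 110a `pattern_poly_smooth` termwise).
* §2 **`sum_levelWeight_trace_le_of_junta`** — exact design `(n,t,T,D,B_v,C,w)`, `A` with `2|A| ≤ t+2`, `2|A|+t ≤ n+2` (NO `|A| ≤ D`), `X` a psd
  `A`-junta field, `Y` ANY psd matching field, `tr(X_U Y_M) ≤ Λ_M`, `Λ̄ := |PM|⁻¹Σ_M Λ_M`: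
  `Σ_UΣ_M W(U,M)·tr(X_U Y_M) ≤ B_v·C(T,D+1)·Λ̄·4^{|A|}·C(|A|,D+1)(D+1)!·N^{|A|−D−1}/[N]_{|A|}` (`N = n/2`). Per matching: window enlarged to exactly
  `|A|` edges (uniform constants), `value_M = |PM|⁻¹Σ_c w_c P_M(c) = |PM|⁻¹(−P_M(0) + R_M)`, `|R_M| ≤ B_v·C(T,D+1)·max_{[0,T]}|P_M^{(D+1)}|`
  (Literature `IsExactDesign.abs_levelSum_add_le_of_hasDerivAt`, `T ≤ t ≤ N`), `P_M(0) ≥ 0` dropped.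
The readable forms (`N^{x−m}/[N]_x ≤ 2^x/N^m` for `4|A| ≤ n`: `≤ B_v·C(T,D+1)·Λ·8^{|A|}·C(|A|,D+1)(D+1)!/N^{D+1}`; contraction fields of dimension
`r`: normalised value `≤ B_v·C(T,D+1)·8^{|A|}·C(|A|,D+1)(D+1)!/N^{D+1}`, dimension-free; the balanced Chebyshev instance) are the companion brick 110c
`…JuntaRemainderRung`.
READING (MEMO-23 §2). (i) `|A| ≤ D`: `C(|A|,D+1) = 0`, the bound is `0` — N1 is the case of vanishing remainder. (ii) Balanced Chebyshev regime
(`B_v = 20`, `T = Tq n ≍ 4√n`, `D = dq n ≍ n^{1/4}`, `N = n/2`): with `C(T,D+1) ≤ T^{D+1}/(D+1)!` the bound is `≤ 20·r·8^{|A|}·(T|A|/N)^{D+1}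
≈ 20·r·8^{|A|}·(8|A|/√n)^{D+1}`, i.e. `n^{−(D+1)/4}·e^{O(|A|) + (D+1)ln(8|A|)}`: super-polynomially small for every junta size `|A| = O(D)` and still
`≤ n^{−cD}` up to `|A| ≲ D·ln n/(8 ln 8)`; compare brick 89 (`…ExtrapolatedSign`: Gram degree `≤ 0.18·D·ln n`, M-AVERAGED, contraction `Y`, error
`2^{2k+1} r√P_D` by extrapolation stability) — here PER MATCHING, any psd `Y`, by profile smoothness. (iii) The factor `8^{|A|} = 2^{|W|}·2^{|A|}`
is the price of bounding pattern by pattern; for the H-SYMMETRIC class at `|H| ≍ n` (eng CG1SYM law `≈ A_D Πc·N^{−(3D+1)/2}`) the smallness is a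
cancellation BETWEEN the patterns (CLT-scale smoothness of hypergeometric profiles), not covered here — that is the open analytic core of (P2).
[cite: Rothvoss2017, §2 (PDF p. 6)] [cite: Grigoriev2001, Lemma 1.4 (PDF p. 8)] [cite: Agarwal2000DifferenceEquations, Remark 1.8.1 (1.8.8)]
[cite: CoppersmithRivlin1992, Thm. (p. 970)] [cite: GriblingDelaatLaurent2019, §5]
Stature: support/instrument (kernel lane, no defs, axioms standard). WHAT THIS IS NOT: nothing on non-junta cut fields, on tightness, or on juntas of
size `≫ D ln n`; no proof or refutation of `TracialDecayExp20`, nothing on psd rank of P_PM(K_n), no P-vs-NP content. Supports stmt-PneNP-19878.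
-/

set_option linter.dupNamespace false -- `Summit.PneNP.PneNP.…`: summit = sub-problem (D-0017)

noncomputable section

namespace Summit.PneNP.PneNP.Theorems.ChebyshevTracialDesignJuntaRemainderPricing

open Finset Polynomial Literature.Barriers.PneNP
open Summit.PneNP.PneNP.Theorems.ChebyshevTracialDesignJunta (card_fiber_eq card_eq_cr_add_two_mul_in sum_oddSet_level_eq
  card_window_edges_le subset_verts_window two_mul_card_pmatch card_filter_cr_in_eq)
open Summit.PneNP.PneNP.Theorems.ChebyshevTracialDesignPatternProfileSmoothness (pattern_poly_smooth)

/-! ### §1 The junta profile polynomial with bounds on all its derivatives -/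

section SumLaw

variable {V : Type*} [DecidableEq V]

/-- The window of a sub-matching `E ⊆ M` (the vertices of `S` covered by `E`) has at most `2|E|` vertices. [folklore] -/
theorem card_window_le {S : Finset V} {M E : Finset (Sym2 V)} (hM : IsPMOn S M) (hE : E ⊆ M) :
    (S.filter fun v => ∃ e ∈ E, v ∈ e).card ≤ 2 * E.card := by
  have hW : (S.filter fun v => ∃ e ∈ E, v ∈ e) = E.biUnion fun e => S.filter fun v => v ∈ e := by
    ext v
    simp only [mem_filter, mem_biUnion]
    constructor
    · rintro ⟨hv, e, he, hve⟩; exact ⟨e, he, hv, hve⟩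
    · rintro ⟨e, he, hv, hve⟩; exact ⟨hv, e, he, hve⟩
  rw [hW]
  refine card_biUnion_le.trans ?_
  calc ∑ e ∈ E, (S.filter fun v => v ∈ e).card ≤ ∑ _e ∈ E, 2 := sum_le_sum fun e he => by
        rw [card_filter_mem_eq_cutCount S (hM.2.1 e (hE he))]
        exact cutCount_le_two S e
    _ = 2 * E.card := by rw [sum_const, smul_eq_mul, mul_comm]

/-- **JUNTA PROFILES ARE SMOOTH** (the junta sum law of `…JuntaPatternLaw.junta_sum_law` with derivative bounds). For a perfect matching `M` of `S`
with `N = |M|` edges, window edges `E ⊆ M` (`x = |E|`, covering `W`, in the range `2x ≤ t+2`, `2x + t ≤ 2N + 2`, `t ≤ 2N`), and a function `G` of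
`U ⊆ S` depending on `t`-sets only on `U ∩ W`, with values `Λ(B) ∈ [0, Λ_max]`: the level sums `Σ_{U : c crossing, i internal} G(U)` along `c + 2i = t`
equal `T(N; c, i)·P(c)` for ONE real polynomial `P` of degree `≤ x` with `P(0) ≥ 0` AND `|P^{(m)}(ξ)| ≤ Λ_max·2^{|W|}·C(x,m)·m!·N^{x−m}/[N]_x` for
every order `m` and every `ξ ∈ [0, N]` (`P = Σ_{B ⊆ W} Λ(B)·P_B`, each pattern polynomial smooth by `pattern_poly_smooth`). [folklore] -/
theorem junta_sum_law_smooth {S : Finset V} {M E : Finset (Sym2 V)} (hM : IsPMOn S M) (hE : E ⊆ M) {t : ℕ}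
    (ht : 2 * E.card ≤ t + 2) (hn : 2 * E.card + t ≤ 2 * M.card + 2) (htN : t ≤ 2 * M.card) (G Λ : Finset V → ℝ)
    (hG : ∀ U, U ⊆ S → U.card = t → G U = Λ (U ∩ S.filter fun v => ∃ e ∈ E, v ∈ e))
    (hΛ : ∀ B, 0 ≤ Λ B) {Λmax : ℝ} (hΛmax : ∀ B, Λ B ≤ Λmax) :
    ∃ P : Polynomial ℝ, P.natDegree ≤ E.card ∧ 0 ≤ P.eval 0 ∧
      (∀ c i : ℕ, c + 2 * i = t →
        ∑ U ∈ S.powerset.filter (fun U => (M.filter fun e => cutCount U e = 1).card = c ∧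
            (M.filter fun e => cutCount U e = 2).card = i), G U =
          ((M.card.choose (c + i) * (c + i).choose i * 2 ^ c : ℕ) : ℝ) * P.eval (c : ℝ)) ∧
      ∀ (m : ℕ) (ξ : ℝ), 0 ≤ ξ → ξ ≤ M.card →
        |(derivative^[m] P).eval ξ| ≤ Λmax * (2 : ℝ) ^ (S.filter fun v => ∃ e ∈ E, v ∈ e).card *
          (((E.card.choose m : ℕ) : ℝ) * (m.factorial : ℝ) * (M.card : ℝ) ^ (E.card - m) / (M.card.descFactorial E.card : ℝ)) := by
  classical
  have hxN : E.card ≤ M.card := card_le_card hE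
  have hyz : ∀ B : Finset V, (E.filter fun e => cutCount B e = 1).card +
      (E.filter fun e => cutCount B e = 2).card ≤ E.card := by
    intro B
    rw [← card_union_of_disjoint (disjoint_filter.2 fun e _ h1 h2 => by omega)]
    exact card_le_card (union_subset (filter_subset _ _) (filter_subset _ _))
  have hP : ∀ B : Finset V, ∃ P : Polynomial ℝ, P.natDegree ≤ E.card ∧ 0 ≤ P.eval 0 ∧
      (∀ c i : ℕ, c + 2 * i = t →
        (((if (E.filter fun e => cutCount B e = 1).card ≤ c ∧ (E.filter fun e => cutCount B e = 2).card ≤ i then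
            (M.card - E.card).choose (c - (E.filter fun e => cutCount B e = 1).card +
                (i - (E.filter fun e => cutCount B e = 2).card)) *
              (c - (E.filter fun e => cutCount B e = 1).card +
                (i - (E.filter fun e => cutCount B e = 2).card)).choose
                  (i - (E.filter fun e => cutCount B e = 2).card) *
              2 ^ (c - (E.filter fun e => cutCount B e = 1).card) else 0 : ℕ)) : ℝ) =
          ((M.card.choose (c + i) * (c + i).choose i * 2 ^ c : ℕ) : ℝ) * P.eval (c : ℝ)) ∧
      ∀ (m : ℕ) (ξ : ℝ), 0 ≤ ξ → ξ ≤ M.card →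
        |(derivative^[m] P).eval ξ| ≤
          ((E.card.choose m : ℕ) : ℝ) * (m.factorial : ℝ) * (M.card : ℝ) ^ (E.card - m) / (M.card.descFactorial E.card : ℝ) :=
    fun B => pattern_poly_smooth M.card t hxN (hyz B) ht hn htN
  choose P hPdeg hP0 hPval hPsm using hP
  set W := S.filter fun v => ∃ e ∈ E, v ∈ e with hW
  refine ⟨∑ B ∈ W.powerset, C (Λ B) * P B, ?_, ?_, ?_, ?_⟩
  · exact natDegree_sum_le_of_forall_le _ _ fun B _ => (natDegree_C_mul_le _ _).trans (hPdeg B)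
  · rw [eval_finsetSum]
    exact sum_nonneg fun B _ => by rw [eval_mul, eval_C]; exact mul_nonneg (hΛ B) (hP0 B)
  · intro c i hci
    rw [← sum_fiberwise_of_maps_to (g := fun U => U ∩ W) (t := W.powerset)
      (fun U _ => mem_powerset.2 inter_subset_right), eval_finsetSum, mul_sum]
    refine sum_congr rfl fun B hB => ?_
    have hconst : ∀ U ∈ (S.powerset.filter fun U => (M.filter fun e => cutCount U e = 1).card = c ∧
        (M.filter fun e => cutCount U e = 2).card = i).filter (fun U => U ∩ W = B), G U = Λ B := by
      intro U hU
      simp only [mem_filter, mem_powerset] at hU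
      obtain ⟨⟨hUS, hc, hi⟩, hUW⟩ := hU
      rw [hG U hUS (by rw [card_eq_cr_add_two_mul_in hM hUS, hc, hi, hci]), hUW]
    rw [sum_congr rfl hconst, sum_const, nsmul_eq_mul, filter_filter]
    have hfib := card_fiber_eq hM hE (mem_powerset.1 hB) c i
    rw [← hW] at hfib
    have hset : (S.powerset.filter fun U => ((M.filter fun e => cutCount U e = 1).card = c ∧
          (M.filter fun e => cutCount U e = 2).card = i) ∧ U ∩ W = B) =
        S.powerset.filter fun U => (M.filter fun e => cutCount U e = 1).card = c ∧
          (M.filter fun e => cutCount U e = 2).card = i ∧ U ∩ W = B :=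
      filter_congr fun U _ => and_assoc
    rw [hset, hfib, hPval B c i hci, eval_mul, eval_C]
    ring
  · intro m ξ hξ0 hξN
    set R : ℝ := ((E.card.choose m : ℕ) : ℝ) * (m.factorial : ℝ) * (M.card : ℝ) ^ (E.card - m) / (M.card.descFactorial E.card : ℝ)
      with hR
    have hR0 : 0 ≤ R := by rw [hR]; positivity
    have hΛmax0 : 0 ≤ Λmax := (hΛ ∅).trans (hΛmax ∅)
    rw [iterate_derivative_sum, eval_finsetSum]
    calc |∑ B ∈ W.powerset, (derivative^[m] (C (Λ B) * P B)).eval ξ|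
        ≤ ∑ B ∈ W.powerset, |(derivative^[m] (C (Λ B) * P B)).eval ξ| := abs_sum_le_sum_abs _ _
      _ ≤ ∑ B ∈ W.powerset, Λmax * R := sum_le_sum fun B _ => by
          rw [iterate_derivative_C_mul, eval_mul, eval_C, abs_mul, abs_of_nonneg (hΛ B)]
          exact mul_le_mul (hΛmax B) (hPsm B m ξ hξ0 hξN) (abs_nonneg _) hΛmax0
      _ = Λmax * (2 : ℝ) ^ W.card * R := by rw [sum_const, card_powerset, nsmul_eq_mul]; push_cast; ring

end SumLaw

/-! ### §2 Per-matching junta pricing beyond the design degree -/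

section Design

open Matrix Literature.Combinatorics.Optimization

variable {n : ℕ}

/-- **JUNTA PRICING BEYOND THE DESIGN DEGREE (per matching, every dimension, every psd matching side).** Let `(n, t, T, D, B_v, C, w)` be an exact
design, `A` a vertex set with `2|A| ≤ t + 2` and `2|A| + t ≤ n + 2` (NO hypothesis `|A| ≤ D`), `X` a psd `A`-junta field on the odd cuts (`X_U` depends
only on `U ∩ A`), `Y` any psd field on the perfect matchings, and `tr(X_U Y_M) ≤ Λ_M` for each `M`. Then, with `N = n/2` and `Λ̄ = |PM|⁻¹Σ_M Λ_M`,
`Σ_U Σ_M W(U,M)·tr(X_U Y_M) ≤ B_v·C(T, D+1)·Λ̄·4^{|A|}·C(|A|, D+1)·(D+1)!·N^{|A|−D−1}/[N]_{|A|}` (so a matching side concentrated on ONE matching `M₀`,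
`Λ = Λ·δ_{M₀}`, is priced at the per-matching scale `|PM|⁻¹`).
MECHANISM: per matching the level profile of `U ↦ tr(X_U Y_M)` is `T(N;c,i)·P_M(c)` with `deg P_M ≤ |A|`, `P_M(0) ≥ 0` and
`|P_M^{(D+1)}| ≤ Λ_M·4^{|A|}·C(|A|,D+1)(D+1)!·N^{|A|−D−1}/[N]_{|A|}` on `[0, N] ⊇ [0, T]` (`junta_sum_law_smooth` on a window of exactly `|A|` edges), so the
design value at `M` is `|PM|⁻¹·Σ_c w_c P_M(c) = |PM|⁻¹·(−P_M(0) + Newton remainder) ≤ |PM|⁻¹·B_v·C(T,D+1)·max|P_M^{(D+1)}|`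
(Literature `IsExactDesign.abs_levelSum_add_le_of_hasDerivAt`). For `|A| ≤ D` the bound is `0`: junta virtual positivity
(`…JuntaVirtualPositivity.sum_levelWeight_trace_nonpos_of_junta`) is the case of vanishing remainder.
[cite: Rothvoss2017, §2 (PDF p. 6)] [cite: Grigoriev2001, Lemma 1.4 (PDF p. 8)] [cite: Agarwal2000DifferenceEquations, Remark 1.8.1 (1.8.8)] -/
theorem sum_levelWeight_trace_le_of_junta {t T D : ℕ} {Bv : ℝ} {C : Finset ℕ} {w : ℕ → ℝ}
    (hdes : IsExactDesign n t T D Bv C w) {r : ℕ} (A : Finset (Fin n))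
    (hAt : 2 * A.card ≤ t + 2) (hAn : 2 * A.card + t ≤ n + 2)
    (X : OddSet n → Matrix (Fin r) (Fin r) ℝ) (Y : PMatch n → Matrix (Fin r) (Fin r) ℝ)
    (hX : ∀ U U' : OddSet n, U.1 ∩ A = U'.1 ∩ A → X U = X U')
    (hXpsd : ∀ U, (X U).PosSemidef) (hYpsd : ∀ M, (Y M).PosSemidef) (Λ : PMatch n → ℝ) (hΛ : ∀ U M, (X U * Y M).trace ≤ Λ M) :
    ∑ U, ∑ M, levelWeight n t C w U M * (X U * Y M).trace ≤
      Bv * ((T.choose (D + 1) : ℕ) : ℝ) * (((Fintype.card (PMatch n) : ℝ)⁻¹ * ∑ M, Λ M) * (4 : ℝ) ^ A.card *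
        (((A.card.choose (D + 1) : ℕ) : ℝ) * ((D + 1).factorial : ℝ) * (((n / 2 : ℕ) : ℝ)) ^ (A.card - (D + 1)) /
          ((n / 2).descFactorial A.card : ℝ))) := by
  classical
  have htodd : Odd t := hdes.1
  have htn : 2 * t + 2 ≤ n := hdes.2.1
  have hTt : T ≤ t := hdes.2.2.1
  have hC := hdes.2.2.2.1
  have hnorm := hdes.2.2.2.2.1
  -- the design has a level, hence `3 ≤ t`, cuts and matchings exist, and `0 ≤ Λ`
  have hCne : C.Nonempty := by
    by_contra h0
    rw [not_nonempty_iff_eq_empty] at h0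
    rw [h0, sum_empty] at hnorm
    exact zero_ne_one hnorm
  obtain ⟨c₀, hc₀⟩ := hCne
  have ht3 : 3 ≤ t := (hC c₀ hc₀).2.1.trans ((hC c₀ hc₀).2.2.1.trans hTt)
  obtain ⟨q₀, hq₀⟩ := (hC c₀ hc₀).2.2.2
  have htr : ∀ (U : OddSet n) (M : PMatch n), 0 ≤ (X U * Y M).trace := fun U M =>
    (show HasPsdFactorization (fun U M => (X U * Y M).trace) r from ⟨X, Y, hXpsd, hYpsd, fun _ _ => rfl⟩).nonneg U M
  have hΛ0 : ∀ M, 0 ≤ Λ M := fun M => (htr q₀.1 M).trans (hΛ q₀.1 M)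
  have hN : ∀ M : PMatch n, M.1.card = n / 2 := fun M => by have := two_mul_card_pmatch M; omega
  have hAN : A.card ≤ n / 2 := by omega
  have htN : t ≤ 2 * (n / 2) := by omega
  -- the uniform remainder constant
  set R : ℝ := ((A.card.choose (D + 1) : ℕ) : ℝ) * ((D + 1).factorial : ℝ) * (((n / 2 : ℕ) : ℝ)) ^ (A.card - (D + 1)) /
      ((n / 2).descFactorial A.card : ℝ) with hR
  have hR0 : 0 ≤ R := by rw [hR]; positivity
  have hK0 : ∀ M, 0 ≤ Λ M * (4 : ℝ) ^ A.card * R := fun M => by have := hΛ0 M; positivity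
  -- Step 1: the value as level sums
  have hval : ∑ U, ∑ M, levelWeight n t C w U M * (X U * Y M).trace =
      ∑ c ∈ C, w c / ((Qset n t c).card : ℝ) *
        ∑ M : PMatch n, ∑ U : OddSet n, (if U.1.card = t ∧ cc U M = c then (X U * Y M).trace else 0) := by
    calc ∑ U, ∑ M, levelWeight n t C w U M * (X U * Y M).trace
        = ∑ U, ∑ M, ∑ c ∈ C, (if (U, M) ∈ Qset n t c then w c / ((Qset n t c).card : ℝ) * (X U * Y M).trace
            else 0) := by
          refine sum_congr rfl fun U _ => sum_congr rfl fun M _ => ?_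
          rw [levelWeight, sum_mul]
          exact sum_congr rfl fun c _ => by split_ifs <;> simp
      _ = ∑ U, ∑ c ∈ C, ∑ M, (if (U, M) ∈ Qset n t c then w c / ((Qset n t c).card : ℝ) * (X U * Y M).trace
            else 0) := sum_congr rfl fun U _ => sum_comm
      _ = ∑ c ∈ C, ∑ U, ∑ M, (if (U, M) ∈ Qset n t c then w c / ((Qset n t c).card : ℝ) * (X U * Y M).trace
            else 0) := sum_comm
      _ = ∑ c ∈ C, w c / ((Qset n t c).card : ℝ) *
            ∑ M : PMatch n, ∑ U : OddSet n, (if U.1.card = t ∧ cc U M = c then (X U * Y M).trace else 0) := by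
          refine sum_congr rfl fun c _ => ?_
          rw [mul_sum, sum_comm]
          refine sum_congr rfl fun M _ => ?_
          rw [mul_sum]
          refine sum_congr rfl fun U _ => ?_
          simp only [mem_Qset_iff]
          split_ifs <;> simp
  -- Step 2: per matching, the smooth junta profile polynomial on a window of exactly `|A|` edges
  have hP : ∀ M : PMatch n, ∃ P : Polynomial ℝ, 0 ≤ P.eval 0 ∧ (∀ c i : ℕ, c + 2 * i = t →
      ∑ U : OddSet n, (if U.1.card = t ∧ cc U M = c then (X U * Y M).trace else 0) =
        (((n / 2).choose (c + i) * (c + i).choose i * 2 ^ c : ℕ) : ℝ) * P.eval (c : ℝ)) ∧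
      ∀ (m : ℕ) (ξ : ℝ), 0 ≤ ξ → ξ ≤ ((n / 2 : ℕ) : ℝ) →
        |(derivative^[m] P).eval ξ| ≤ Λ M * (4 : ℝ) ^ A.card *
          (((A.card.choose m : ℕ) : ℝ) * (m.factorial : ℝ) * (((n / 2 : ℕ) : ℝ)) ^ (A.card - m) / ((n / 2).descFactorial A.card : ℝ)) := by
    intro M
    set E₀ := M.1.filter (fun e => ∃ a ∈ A, a ∈ e) with hE₀
    have hE₀M : E₀ ⊆ M.1 := filter_subset _ _
    have hE₀A : E₀.card ≤ A.card := card_window_edges_le M A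
    obtain ⟨E, hE₀E, hEM, hEcard⟩ := exists_subsuperset_card_eq hE₀M hE₀A (by rw [hN M]; exact hAN)
    set W := (univ : Finset (Fin n)).filter (fun v => ∃ e ∈ E, v ∈ e) with hW
    have hAW : A ⊆ W := by
      intro a ha
      obtain ⟨e, he, hae⟩ := mem_filter.1 (subset_verts_window M A ha) |>.2
      exact mem_filter.2 ⟨mem_univ a, e, hE₀E he, hae⟩
    have hWcard : W.card ≤ 2 * A.card := by rw [← hEcard]; exact card_window_le M.2 hEM
    obtain ⟨P, -, hP0, hPval, hPsm⟩ := junta_sum_law_smooth M.2 hEM (t := t) (by rw [hEcard]; exact hAt)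
      (by rw [hEcard, hN M]; omega) (by rw [hN M]; exact htN)
      (fun U' => if h : Odd U'.card then (X ⟨U', h⟩ * Y M).trace else 0)
      (fun B => if h : ∃ U : OddSet n, U.1.card = t ∧ U.1 ∩ W = B then (X h.choose * Y M).trace else 0)
      (fun U' _ hU't => by
        have hodd : Odd U'.card := hU't ▸ htodd
        have hex : ∃ U : OddSet n, U.1.card = t ∧ U.1 ∩ W = U' ∩ W := ⟨⟨U', hodd⟩, hU't, rfl⟩
        simp only [dif_pos hodd]
        rw [← hW, dif_pos hex]
        have hXeq : X ⟨U', hodd⟩ = X hex.choose := by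
          refine hX _ _ ?_
          have h2 := hex.choose_spec.2
          calc U' ∩ A = (U' ∩ W) ∩ A := by rw [inter_assoc, inter_eq_right.2 hAW]
            _ = (hex.choose.1 ∩ W) ∩ A := by rw [h2]
            _ = hex.choose.1 ∩ A := by rw [inter_assoc, inter_eq_right.2 hAW]
        rw [hXeq])
      (fun B => by
        split_ifs with h
        · exact htr _ _
        · exact le_refl _)
      (Λmax := Λ M) (fun B => by
        split_ifs with h
        · exact hΛ _ _
        · exact hΛ0 M)
    refine ⟨P, hP0, fun c i hci => ?_, fun m ξ hξ0 hξN => ?_⟩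
    · rw [sum_oddSet_level_eq M hci X Y, hPval c i hci, hN M]
    · have h1 := hPsm m ξ hξ0 (by rw [hN M]; exact hξN)
      rw [hEcard, hN M] at h1
      refine h1.trans ?_
      rw [← hW]
      have h4 : (2 : ℝ) ^ W.card ≤ (4 : ℝ) ^ A.card := by
        calc (2 : ℝ) ^ W.card ≤ (2 : ℝ) ^ (2 * A.card) := pow_le_pow_right₀ (by norm_num) hWcard
          _ = (4 : ℝ) ^ A.card := by rw [pow_mul]; norm_num
      have hR' : 0 ≤ ((A.card.choose m : ℕ) : ℝ) * (m.factorial : ℝ) * (((n / 2 : ℕ) : ℝ)) ^ (A.card - m) /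
          ((n / 2).descFactorial A.card : ℝ) := by positivity
      exact mul_le_mul_of_nonneg_right (mul_le_mul_of_nonneg_left h4 (hΛ0 M)) hR'
  choose P hP0 hPval hPsm using hP
  -- Step 3: `|Q_c| = #PM · T(n/2; c, i)`
  have hQ : ∀ c i : ℕ, c + 2 * i = t → ((Qset n t c).card : ℝ) =
      (Fintype.card (PMatch n) : ℝ) * (((n / 2).choose (c + i) * (c + i).choose i * 2 ^ c : ℕ) : ℝ) := by
    intro c i hci
    have e1 : ((Qset n t c).card : ℝ) =
        ∑ M : PMatch n, ∑ U : OddSet n, (if U.1.card = t ∧ cc U M = c then (1 : ℝ) else 0) := by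
      rw [Qset, Finset.card_filter, Nat.cast_sum, Fintype.sum_prod_type, sum_comm]
      refine sum_congr rfl fun M _ => sum_congr rfl fun U _ => ?_
      split_ifs <;> simp
    have e2 : ∀ M : PMatch n, ∑ U : OddSet n, (if U.1.card = t ∧ cc U M = c then (1 : ℝ) else 0) =
        (((n / 2).choose (c + i) * (c + i).choose i * 2 ^ c : ℕ) : ℝ) := by
      intro M
      have key := sum_oddSet_level_eq M hci (r := 1) (fun _ => 1) (fun _ => 1)
      simp only [Matrix.mul_one, trace_one, Fintype.card_fin, Nat.cast_one, dite_eq_ite] at key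
      rw [key]
      have hodd : ∀ U' ∈ (univ : Finset (Fin n)).powerset.filter (fun U' =>
          (M.1.filter fun e => cutCount U' e = 1).card = c ∧ (M.1.filter fun e => cutCount U' e = 2).card = i),
          (if Odd U'.card then (1 : ℝ) else 0) = 1 := by
        intro U' hU'
        rw [mem_filter] at hU'
        have hc := card_eq_cr_add_two_mul_in M.2 (subset_univ U')
        rw [hU'.2.1, hU'.2.2, hci] at hc
        rw [if_pos (hc ▸ htodd)]
      rw [sum_congr rfl hodd, sum_const, nsmul_eq_mul, mul_one, card_filter_cr_in_eq M.2, hN M]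
    rw [e1, Fintype.sum_congr _ _ e2, sum_const, card_univ, nsmul_eq_mul]
  -- Step 4: per matching, the design prices `P_M` at `−P_M(0)` up to the Newton remainder
  have hPM0 : (0 : ℝ) < Fintype.card (PMatch n) := by
    have : 0 < Fintype.card (PMatch n) := Fintype.card_pos_iff.2 ⟨q₀.2⟩
    exact_mod_cast this
  have hTN : (T : ℝ) ≤ ((n / 2 : ℕ) : ℝ) := by exact_mod_cast (by omega : T ≤ n / 2)
  have hrem : ∀ M : PMatch n, ∑ c ∈ C, w c * (P M).eval (c : ℝ) ≤ Bv * ((T.choose (D + 1) : ℕ) : ℝ) * (Λ M * (4 : ℝ) ^ A.card * R) := by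
    intro M
    have h := hdes.abs_levelSum_add_le_of_hasDerivAt (fun k ξ => (derivative^[k] (P M)).eval ξ) (hK0 M)
      (fun k _ ξ _ => by
        have hd := Polynomial.hasDerivAt (derivative^[k] (P M)) ξ
        rwa [← Function.iterate_succ_apply' derivative k (P M)] at hd)
      (fun ξ hξ => hPsm M (D + 1) ξ hξ.1 (hξ.2.trans hTN))
    simp only [Function.iterate_zero, id_eq] at h
    have h' := (abs_le.1 h).2
    linarith [hP0 M]
  -- Step 5: assemble
  rw [hval]
  have hterm : ∀ c ∈ C, w c / ((Qset n t c).card : ℝ) *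
      ∑ M : PMatch n, ∑ U : OddSet n, (if U.1.card = t ∧ cc U M = c then (X U * Y M).trace else 0) =
      (Fintype.card (PMatch n) : ℝ)⁻¹ * ∑ M : PMatch n, w c * (P M).eval (c : ℝ) := by
    intro c hc
    obtain ⟨hcodd, -, hcT, hne⟩ := hC c hc
    obtain ⟨i, hi⟩ : ∃ i, c + 2 * i = t := by
      obtain ⟨a, ha⟩ := hcodd; obtain ⟨b, hb⟩ := htodd; exact ⟨b - a, by omega⟩
    have hQc := hQ c i hi
    have hQ0 : ((Qset n t c).card : ℝ) ≠ 0 := by exact_mod_cast (card_pos.2 hne).ne'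
    have hT0 : (((n / 2).choose (c + i) * (c + i).choose i * 2 ^ c : ℕ) : ℝ) ≠ 0 := by
      intro h0; rw [h0, mul_zero] at hQc; exact hQ0 hQc
    rw [sum_congr rfl fun M _ => hPval M c i hi, ← mul_sum, hQc, mul_sum, mul_sum, mul_sum]
    refine sum_congr rfl fun M _ => ?_
    field_simp
  rw [sum_congr rfl hterm, ← mul_sum, sum_comm]
  calc (Fintype.card (PMatch n) : ℝ)⁻¹ * ∑ M : PMatch n, ∑ c ∈ C, w c * (P M).eval (c : ℝ)
      ≤ (Fintype.card (PMatch n) : ℝ)⁻¹ * ∑ M : PMatch n, Bv * ((T.choose (D + 1) : ℕ) : ℝ) * (Λ M * (4 : ℝ) ^ A.card * R) :=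
        mul_le_mul_of_nonneg_left (sum_le_sum fun M _ => hrem M) (inv_nonneg.2 hPM0.le)
    _ = _ := by rw [hR, ← mul_sum, ← sum_mul, ← sum_mul]; ring

end Design

end Summit.PneNP.PneNP.Theorems.ChebyshevTracialDesignJuntaRemainderPricing
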